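import Summits.AtomisticToContinuum.Crystallization.Theorems.ChartedZeroExcessLayeredLatticeLiouvilleZW
import Summits.AtomisticToContinuum.Crystallization.Theorems.ChartedZeroExcessLayeredLatticeLiouvilleZX

/-!
# Part ZY «The family pick and the affine layer law: after one re-slicing, an all-c window is plane-registered» (lens-2 g79, NODE 79 rider 8 = M3 of
memo §13/§14; imports ZW + ZX)

The combinatorial half of the transverse regime (L2-C⟂′T), COMPLETE up to the metric transport (LEMMA B) and C's own chart (LEMMA C) of g80.  Setting of
Parts ZV/ZW: a map `g : ℤ³ → ℤ³` which is a LINK MAP (`IsLinkMap τ τ' g x`) at every vertex of a window `W` and at its neighbours.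
* ZY-1 LETTERS.  `BarlowAdj τ p q` reads `τ` only at the lower of the two layers (`barlowAdj_congr_of`), so a link map into `B_τ'` at `x` is a link map into
  the constant-letter graph `B_b` once `τ' = b` at `(g x).1 − 1`, `(g x).1` (`IsLinkMap.toConst`); on the all-c branch of ZW's dichotomy the letter
  `τ' (g ·).1` is constant along Barlow paths in `W` (`letter_eq_of_reflTransGen`) — together: the whole window maps by link maps into ONE `B_b`.
* ZY-2 TRANSPORT.  Composing with a re-slicing `resliceInv b f` (an automorphism of `B_b`, Part ZX) keeps link maps (`IsLinkMap.reslice`).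
* ZY-3 ★★ THE FAMILY PICK (finite core `famCaps_of_noCross_bool`, one closed `Bool` by `decide`, kernel-checked: in the link of a c-vertex two triangles with
  no adjacency between them are the caps of the old slicing or of one of the three new ones; `tri_isCap_bool`: each of the eight triangles is a cap of one
  of the four): `IsLinkMap.capType_or_fam` — under a link map into `B_b` a vertex is cap-type, or cap-type for `resliceInv b f ∘ g` for some `f : Fin 3`.
* ZY-4 ★★★ `exists_reslice_capType` — on a Barlow-connected window there is ONE `φ ∈ {id, resliceInv b 0, resliceInv b 1, resliceInv b 2}` after which EVERY
  vertex is cap-type for `φ ∘ g` (family pick at the base vertex + ZW's propagation `CapType.of_reflTransGen` for `φ ∘ g`).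
* ZY-5 ★★★ ORIENTATION AND THE AFFINE LAYER LAW: a cap-type vertex has an orientation sign `s = ±1` (`UpSign`: upper cap ↦ layer `+s`, lower ↦ `−s`);
  adjacent cap-type vertices have the same sign (`UpSign.of_barlowAdj`: sheet neighbours through their common upper neighbour, cross neighbours through the
  opposite triangle of the neighbour); hence (`layer_affine_of_reflTransGen`) `(g x).1 − s·x.1` is CONSTANT on the window, and `exists_reslice_layerLaw`
  assembles: after one re-slicing, `(φ (g x)).1 = (φ (g y)).1 + s·(x.1 − y.1)` on `W` with sheet neighbours in equal layers — source sheet `k` goes INTO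
  target sheet `L₀ + s·k` of the re-sliced chart: PLANE REGISTRATION of the parallel type, the input of the (L2-C⟂′∥) engine (riders ZR/ZS) in the new
  coordinates.
Pure combinatorics over `BarlowAdj`; 0 sorry; no `native_decide`.
-/

namespace Summit.AtomisticToContinuum.Crystallization.Theorems.ChartedZeroExcessLayeredLatticeLiouville

/-! ## ZY-1  Letters: what adjacency reads, conditional congruence, constant letters along an all-c window -/

/-- adjacent sites are in the same or in adjacent layers. [formal bookkeeping] -/
theorem BarlowAdj.fst_cases {τ : ℤ → Bool} {p q : ℤ × ℤ × ℤ} (h : BarlowAdj τ p q) : q.1 = p.1 ∨ q.1 = p.1 + 1 ∨ p.1 = q.1 + 1 :=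
  h.elim (fun h => Or.inl h.1) fun h => h.elim (fun h => Or.inr (Or.inl h.1)) fun h => Or.inr (Or.inr h.1)

/-- `BarlowAdj τ p q` reads `τ` only at the LOWER of the two layers: at `p.1` if `q` is above `p`, at `q.1` if `p` is above `q`. [formal bookkeeping] -/
theorem barlowAdj_congr_of {τ τ'' : ℤ → Bool} {p q : ℤ × ℤ × ℤ} (hp : q.1 = p.1 + 1 → τ p.1 = τ'' p.1) (hq : p.1 = q.1 + 1 → τ q.1 = τ'' q.1) :
    BarlowAdj τ p q ↔ BarlowAdj τ'' p q := by
  constructor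
  · rintro (h | ⟨e, hc⟩ | ⟨e, hc⟩)
    · exact Or.inl h
    · exact Or.inr (Or.inl ⟨e, by rw [← hp e]; exact hc⟩)
    · exact Or.inr (Or.inr ⟨e, by rw [← hq e]; exact hc⟩)
  · rintro (h | ⟨e, hc⟩ | ⟨e, hc⟩)
    · exact Or.inl h
    · exact Or.inr (Or.inl ⟨e, by rw [hp e]; exact hc⟩)
    · exact Or.inr (Or.inr ⟨e, by rw [hq e]; exact hc⟩)

/-- the image of a link lies in the three layers around the image vertex. [formal bookkeeping] -/
theorem IsLinkMap.fst_cases {τ τ' : ℤ → Bool} {g : ℤ × ℤ × ℤ → ℤ × ℤ × ℤ} {x : ℤ × ℤ × ℤ} (h : IsLinkMap τ τ' g x) (i : Fin 12) :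
    (g (linkPt τ x i)).1 = (g x).1 ∨ (g (linkPt τ x i)).1 = (g x).1 + 1 ∨ (g x).1 = (g (linkPt τ x i)).1 + 1 :=
  (h.1 i).fst_cases

/-- ★ LETTER SWITCH: a link map into `B_τ'` at `x` is a link map into the constant-letter graph `B_b` as soon as `τ'` equals `b` at the two layers its image
link reads (`(g x).1 − 1` and `(g x).1`). [this file, g79] -/
theorem IsLinkMap.toConst {τ τ' : ℤ → Bool} {g : ℤ × ℤ × ℤ → ℤ × ℤ × ℤ} {x : ℤ × ℤ × ℤ} (h : IsLinkMap τ τ' g x) {b : Bool}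
    (h₁ : τ' ((g x).1 - 1) = b) (h₂ : τ' (g x).1 = b) : IsLinkMap τ (fun _ => b) g x := by
  have key : ∀ p q : ℤ × ℤ × ℤ, (p.1 = (g x).1 ∨ p.1 = (g x).1 + 1 ∨ (g x).1 = p.1 + 1) →
      (q.1 = (g x).1 ∨ q.1 = (g x).1 + 1 ∨ (g x).1 = q.1 + 1) → (BarlowAdj τ' p q ↔ BarlowAdj (fun _ => b) p q) := by
    intro p q hp hq
    refine barlowAdj_congr_of (fun e => ?_) (fun e => ?_)
    · have h' : p.1 = (g x).1 - 1 ∨ p.1 = (g x).1 := by omega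
      rcases h' with e' | e'
      · rw [e']; exact h₁
      · rw [e']; exact h₂
    · have h' : q.1 = (g x).1 - 1 ∨ q.1 = (g x).1 := by omega
      rcases h' with e' | e'
      · rw [e']; exact h₁
      · rw [e']; exact h₂
  exact ⟨fun i => (key _ _ (Or.inl rfl) (h.fst_cases i)).1 (h.1 i), fun i j => (h.2.1 i j).trans (key _ _ (h.fst_cases i) (h.fst_cases j)), h.2.2⟩

/-- one step of letter constancy on the all-c branch. [formal bookkeeping] -/
theorem letter_eq_step {τ τ' : ℤ → Bool} {g : ℤ × ℤ × ℤ → ℤ × ℤ × ℤ} {a c : ℤ × ℤ × ℤ} (ha : IsLinkMap τ τ' g a)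
    (hca : τ' ((g a).1 - 1) = τ' (g a).1) (hcc : τ' ((g c).1 - 1) = τ' (g c).1) (hadj : BarlowAdj τ a c) : τ' (g c).1 = τ' (g a).1 := by
  obtain ⟨i, rfl⟩ := exists_linkPt_of_barlowAdj hadj
  rcases ha.fst_cases i with h1 | h1 | h1
  · rw [h1]
  · have e : (g (linkPt τ a i)).1 - 1 = (g a).1 := by omega
    rw [e] at hcc
    exact hcc.symm
  · have e : (g a).1 - 1 = (g (linkPt τ a i)).1 := by omega
    rw [e] at hca
    exact hca

/-- ★ on the all-c branch (`allC_of_not_capType`, Part ZW) the letter `τ' (g ·).1` is CONSTANT along Barlow paths inside the window; with the all-c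
identities this makes `τ'` constant on every layer the image links read, so `IsLinkMap.toConst` applies throughout. [this file, g79] -/
theorem letter_eq_of_reflTransGen {τ τ' : ℤ → Bool} {g : ℤ × ℤ × ℤ → ℤ × ℤ × ℤ} {W : Set (ℤ × ℤ × ℤ)}
    (hmaps : ∀ z ∈ W, IsLinkMap τ τ' g z) (hc : ∀ z ∈ W, τ' ((g z).1 - 1) = τ' (g z).1) {y x : ℤ × ℤ × ℤ}
    (h : Relation.ReflTransGen (fun a c => a ∈ W ∧ c ∈ W ∧ BarlowAdj τ a c) y x) : τ' (g x).1 = τ' (g y).1 := by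
  induction h with
  | refl => rfl
  | tail _ hbc ih => exact (letter_eq_step (hmaps _ hbc.1) (hc _ hbc.1) (hc _ hbc.2.1) hbc.2.2).trans ih

/-! ## ZY-2  Transport of link maps under a re-slicing of the (constant-letter) target -/

/-- ★ composing with `resliceInv b f` (an automorphism of `B_b`, Part ZX) keeps link maps. [this file, g79] -/
theorem IsLinkMap.reslice {τ : ℤ → Bool} {b : Bool} {g : ℤ × ℤ × ℤ → ℤ × ℤ × ℤ} {x : ℤ × ℤ × ℤ} (h : IsLinkMap τ (fun _ => b) g x)
    (f : Fin 3) : IsLinkMap τ (fun _ => b) (resliceInv b f ∘ g) x := by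
  refine ⟨fun i => ?_, fun i j => ?_, (resliceInv_injective b f).comp h.2.2⟩
  · rw [Function.comp_apply, Function.comp_apply, barlowAdj_resliceInv_iff]; exact h.1 i
  · rw [h.2.1 i j, Function.comp_apply, Function.comp_apply, barlowAdj_resliceInv_iff]

/-! ## ZY-3  ★ The family pick at one vertex (finite core: the four triangle pairs of the cuboctahedral link are the caps of the four slicings) -/

/-- a code triple lies in the NEW upper cap of slicing `f` (new sheet index `+1` at all three codes). [this file, g79] -/
def famUpB (b : Bool) (f : Fin 3) (t : Fin 12 × Fin 12 × Fin 12) : Bool :=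
  (resliceInv b f (linkSite b b t.1)).1 == 1 && (resliceInv b f (linkSite b b t.2.1)).1 == 1 && (resliceInv b f (linkSite b b t.2.2)).1 == 1

/-- … in the NEW lower cap of slicing `f`. [this file, g79] -/
def famLoB (b : Bool) (f : Fin 3) (t : Fin 12 × Fin 12 × Fin 12) : Bool :=
  (resliceInv b f (linkSite b b t.1)).1 == -1 && (resliceInv b f (linkSite b b t.2.1)).1 == -1 && (resliceInv b f (linkSite b b t.2.2)).1 == -1

/-- THE FINITE CORE (one closed `Bool`, `decide`, kernel): in the link of a c-vertex (letters `b, b`) two triangles with no adjacency between them are the two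
caps of the old slicing or of one of the three new slicings. [this file, g79] -/
theorem famCaps_of_noCross_bool : ([true, false].all fun b => (linkTris b b).all fun t => (linkTris b b).all fun u =>
    !crossFreeB b b t u || (upB t && loB u) || (loB t && upB u) ||
      (List.finRange 3).any fun f => (famUpB b f t && famLoB b f u) || (famLoB b f t && famUpB b f u)) = true := by
  decide +kernel

/-- [formal bookkeeping] -/
theorem famCaps_of_noCross (b : Bool) (t u : Fin 12 × Fin 12 × Fin 12) (ht : t ∈ linkTris b b) (hu : u ∈ linkTris b b) (hX : crossFreeB b b t u = true) :
    (upB t = true ∧ loB u = true) ∨ (loB t = true ∧ upB u = true) ∨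
      ∃ f : Fin 3, (famUpB b f t = true ∧ famLoB b f u = true) ∨ (famLoB b f t = true ∧ famUpB b f u = true) := by
  have h1 := List.all_eq_true.mp famCaps_of_noCross_bool b (by cases b <;> simp)
  have h4 := List.all_eq_true.mp (List.all_eq_true.mp h1 t ht) u hu
  rw [hX] at h4
  simp only [Bool.not_true, Bool.false_or, Bool.or_eq_true, Bool.and_eq_true, List.any_eq_true, List.mem_finRange, true_and] at h4
  rcases h4 with (h | h) | ⟨f, h⟩
  · exact Or.inl h
  · exact Or.inr (Or.inl h)
  · exact Or.inr (Or.inr ⟨f, h⟩)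

/-- each of the eight triangles of a c-link is a cap of one of the FOUR slicings (finite). [this file, g79] -/
theorem tri_isCap_bool : ([true, false].all fun b => (linkTris b b).all fun t =>
    upB t || loB t || (List.finRange 3).any fun f => famUpB b f t || famLoB b f t) = true := by
  decide +kernel

/-- ★★ THE FAMILY PICK: under a link map into a constant-letter graph, a vertex is cap-type — or it becomes cap-type after one of the three re-slicings of the
target. [this file, g79] -/
theorem IsLinkMap.capType_or_fam {τ : ℤ → Bool} {b : Bool} {g : ℤ × ℤ × ℤ → ℤ × ℤ × ℤ} {x : ℤ × ℤ × ℤ}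
    (h : IsLinkMap τ (fun _ => b) g x) : CapType τ g x ∨ ∃ f : Fin 3, CapType τ (resliceInv b f ∘ g) x := by
  obtain ⟨c, hI, hc⟩ := h.exists_codeIso
  obtain ⟨h67, h68, h78, h910, h911, h1011, h69, h610, h611, h79, h710, h711, h89, h810, h811⟩ := linkAdj_caps (τ (x.1 - 1)) (τ x.1)
  have T : ∀ i j, linkAdj b b (c i) (c j) = linkAdj (τ (x.1 - 1)) (τ x.1) i j := fun i j => (hI.2 i j).symm
  have ht : (c 6, c 7, c 8) ∈ linkTris b b := mem_linkTris (by rw [T]; exact h67) (by rw [T]; exact h68) (by rw [T]; exact h78)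
  have hu : (c 9, c 10, c 11) ∈ linkTris b b := mem_linkTris (by rw [T]; exact h910) (by rw [T]; exact h911) (by rw [T]; exact h1011)
  have hX : crossFreeB b b (c 6, c 7, c 8) (c 9, c 10, c 11) = true := by
    simp [crossFreeB, T, h69, h610, h611, h79, h710, h711, h89, h810, h811]
  rcases famCaps_of_noCross _ _ _ ht hu hX with ⟨h1, h2⟩ | ⟨h1, h2⟩ | ⟨f, hf⟩
  · left; rw [capType_iff_codes hc]; intro i hi
    simp only [upB, loB, Bool.and_eq_true, decide_eq_true_eq] at h1 h2
    rcases cross_code_cases i hi with rfl | rfl | rfl | rfl | rfl | rfl <;> omega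
  · left; rw [capType_iff_codes hc]; intro i hi
    simp only [upB, loB, Bool.and_eq_true, decide_eq_true_eq] at h1 h2
    rcases cross_code_cases i hi with rfl | rfl | rfl | rfl | rfl | rfl <;> omega
  · right
    refine ⟨f, fun i hi => ?_⟩
    rw [Function.comp_apply, Function.comp_apply, hc i, show linkPt (fun _ => b) (g x) (c i) = g x + linkSite b b (c i) from rfl, resliceInv_add,
      Prod.fst_add]
    rcases hf with ⟨h1, h2⟩ | ⟨h1, h2⟩ <;> simp only [famUpB, famLoB, Bool.and_eq_true, beq_iff_eq] at h1 h2 <;>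
      rcases cross_code_cases i hi with rfl | rfl | rfl | rfl | rfl | rfl <;> omega

/-! ## ZY-4  ★★ The window theorem: after (at most) one re-slicing every vertex of the window is cap-type -/

/-- ★★★ on a Barlow-connected window `W` carrying link maps into a constant-letter graph (on `W` and next to it) there is ONE re-indexing `φ` of the target —
the identity or one of the three `resliceInv b f` — after which EVERY vertex of `W` is cap-type (family pick at the base vertex `y`, Part ZW's propagation
for `φ ∘ g`). [this file, g79] -/
theorem exists_reslice_capType {τ : ℤ → Bool} {b : Bool} {g : ℤ × ℤ × ℤ → ℤ × ℤ × ℤ} {W : Set (ℤ × ℤ × ℤ)}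
    (hmaps : ∀ z ∈ W, IsLinkMap τ (fun _ => b) g z) (hnb : ∀ z ∈ W, ∀ i, IsLinkMap τ (fun _ => b) g (linkPt τ z i)) {y : ℤ × ℤ × ℤ} (hy : y ∈ W)
    (hconn : ∀ x ∈ W, Relation.ReflTransGen (fun a c => a ∈ W ∧ c ∈ W ∧ BarlowAdj τ a c) y x) :
    ∃ φ : ℤ × ℤ × ℤ → ℤ × ℤ × ℤ, (φ = id ∨ ∃ f : Fin 3, φ = resliceInv b f) ∧
      ∀ x ∈ W, IsLinkMap τ (fun _ => b) (φ ∘ g) x ∧ (∀ i, IsLinkMap τ (fun _ => b) (φ ∘ g) (linkPt τ x i)) ∧ CapType τ (φ ∘ g) x := by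
  rcases (hmaps y hy).capType_or_fam with hcap | ⟨f, hcap⟩
  · exact ⟨id, Or.inl rfl, fun x hx => ⟨hmaps x hx, hnb x hx, hcap.of_reflTransGen hmaps hnb (hconn x hx)⟩⟩
  · have hmaps' : ∀ z ∈ W, IsLinkMap τ (fun _ => b) (resliceInv b f ∘ g) z := fun z hz => (hmaps z hz).reslice f
    have hnb' : ∀ z ∈ W, ∀ i, IsLinkMap τ (fun _ => b) (resliceInv b f ∘ g) (linkPt τ z i) := fun z hz i => (hnb z hz i).reslice f
    exact ⟨_, Or.inr ⟨f, rfl⟩, fun x hx => ⟨hmaps' x hx, hnb' x hx, hcap.of_reflTransGen hmaps' hnb' (hconn x hx)⟩⟩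

/-! ## ZY-5  ★ Orientation sign and the AFFINE LAYER LAW (plane registration in the re-sliced coordinates) -/

/-- the ORIENTATION SIGN `s` of a cap-type vertex: its upper cap goes to layer `(g x).1 + s`, its lower cap to `(g x).1 − s`. [this file, g79] -/
def UpSign (τ : ℤ → Bool) (g : ℤ × ℤ × ℤ → ℤ × ℤ × ℤ) (x : ℤ × ℤ × ℤ) (s : ℤ) : Prop :=
  (∀ i : Fin 12, 6 ≤ i.val → i.val ≤ 8 → (g (linkPt τ x i)).1 = (g x).1 + s) ∧ ∀ i : Fin 12, 9 ≤ i.val → (g (linkPt τ x i)).1 = (g x).1 - s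

/-- a cap-type vertex has an orientation sign `±1` (`CapType.sides`, Part ZV). [formal bookkeeping] -/
theorem CapType.exists_upSign {τ τ' : ℤ → Bool} {g : ℤ × ℤ × ℤ → ℤ × ℤ × ℤ} {x : ℤ × ℤ × ℤ} (hcap : CapType τ g x)
    (h : IsLinkMap τ τ' g x) : ∃ s : ℤ, (s = 1 ∨ s = -1) ∧ UpSign τ g x s := by
  rcases hcap.sides h with ⟨hu, hl⟩ | ⟨hu, hl⟩
  · exact ⟨1, Or.inl rfl, hu, hl⟩
  · exact ⟨-1, Or.inr rfl, fun i hi hi' => by rw [hu i hi hi']; ring, fun i hi => by rw [hl i hi]; ring⟩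

/-- ★ SIGN COHERENCE: adjacent cap-type vertices have the same orientation sign (sheet neighbours: through their common upper neighbour; cross neighbours:
through the lower/upper triangle of the neighbour, which lies in `x`'s sheet and `x`). [this file, g79] -/
theorem UpSign.of_barlowAdj {τ τ' : ℤ → Bool} {g : ℤ × ℤ × ℤ → ℤ × ℤ × ℤ} {a c : ℤ × ℤ × ℤ} {s : ℤ} (hs : UpSign τ g a s)
    (ha : IsLinkMap τ τ' g a) (hca : CapType τ g a) (hcc : CapType τ g c) (hc : IsLinkMap τ τ' g c) (hadj : BarlowAdj τ a c) :
    UpSign τ g c s := by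
  obtain ⟨s', -, hs'⟩ := hcc.exists_upSign hc
  suffices e : s' = s by subst e; exact hs'
  obtain ⟨i₀, rfl⟩ := exists_linkPt_of_barlowAdj hadj
  rcases Nat.lt_or_ge i₀.val 6 with hi₀ | hi₀
  · obtain ⟨i, hi, hi', j, hj, e⟩ := exists_common_up τ a i₀ hi₀
    have hadj' : BarlowAdj τ (linkPt τ a i₀) (linkPt τ a i) := by
      have hb := barlowAdj_symm (barlowAdj_linkPt τ (linkPt τ a i) j)
      rw [e] at hb
      exact hb
    obtain ⟨i', e'⟩ := exists_linkPt_of_barlowAdj hadj'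
    have hn1 : (linkPt τ a i).1 = a.1 + 1 := by rw [linkPt_fst, (linkSite_fst_eq_one_iff _ _ i).2 ⟨hi, hi'⟩]
    have hc1 : (linkPt τ a i₀).1 = a.1 := by rw [linkPt_fst, (linkSite_fst_eq_zero_iff _ _ i₀).2 hi₀, add_zero]
    have hi'c : 6 ≤ i'.val ∧ i'.val ≤ 8 := by
      have h1 := linkPt_fst τ (linkPt τ a i₀) i'
      rw [← e', hn1, hc1] at h1
      exact (linkSite_fst_eq_one_iff _ _ i').1 (by linarith)
    have h1 := hs.1 i hi hi'
    have h2 := hca.inLayer ha i₀ hi₀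
    have h3 := hs'.1 i' hi'c.1 hi'c.2
    rw [← e'] at h3
    omega
  rcases Nat.lt_or_ge i₀.val 9 with hi₀' | hi₀'
  · have h1 := hs.1 i₀ hi₀ (by omega)
    have h3 := hs'.2 9 (by decide)
    have h2 : (g (linkPt τ (linkPt τ a i₀) 9)).1 = (g a).1 := by
      rcases linkPt_up_lo τ a i₀ 9 hi₀ (by omega) (by decide) with h0 | ⟨k, hk, hkk⟩
      · rw [h0]
      · rw [hkk]; exact hca.inLayer ha k hk
    omega
  · have h1 := hs.2 i₀ hi₀'
    have h3 := hs'.1 6 (by decide) (by decide)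
    have h2 : (g (linkPt τ (linkPt τ a i₀) 6)).1 = (g a).1 := by
      rcases linkPt_lo_up τ a i₀ 6 hi₀' (by decide) (by decide) with h0 | ⟨k, hk, hkk⟩
      · rw [h0]
      · rw [hkk]; exact hca.inLayer ha k hk
    omega

/-- ★ the sign is constant along Barlow paths in an all-cap-type window. [this file, g79] -/
theorem UpSign.of_reflTransGen {τ τ' : ℤ → Bool} {g : ℤ × ℤ × ℤ → ℤ × ℤ × ℤ} {W : Set (ℤ × ℤ × ℤ)} {y : ℤ × ℤ × ℤ} {s : ℤ}
    (hy : UpSign τ g y s) (hmaps : ∀ z ∈ W, IsLinkMap τ τ' g z) (hcapW : ∀ z ∈ W, CapType τ g z) {x : ℤ × ℤ × ℤ}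
    (h : Relation.ReflTransGen (fun a c => a ∈ W ∧ c ∈ W ∧ BarlowAdj τ a c) y x) : UpSign τ g x s := by
  induction h with
  | refl => exact hy
  | tail _ hbc ih => exact ih.of_barlowAdj (hmaps _ hbc.1) (hcapW _ hbc.1) (hcapW _ hbc.2.1) (hmaps _ hbc.2.1) hbc.2.2

/-- one step of the affine layer law. [formal bookkeeping] -/
theorem layer_affine_step {τ τ' : ℤ → Bool} {g : ℤ × ℤ × ℤ → ℤ × ℤ × ℤ} {a c : ℤ × ℤ × ℤ} {s : ℤ} (hs : UpSign τ g a s)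
    (ha : IsLinkMap τ τ' g a) (hca : CapType τ g a) (hadj : BarlowAdj τ a c) : (g c).1 - s * c.1 = (g a).1 - s * a.1 := by
  obtain ⟨i, rfl⟩ := exists_linkPt_of_barlowAdj hadj
  have hz := linkSite_fst_eq_zero_iff (τ (a.1 - 1)) (τ a.1) i
  have ho := linkSite_fst_eq_one_iff (τ (a.1 - 1)) (τ a.1) i
  have hn := linkSite_fst_eq_neg_one_iff (τ (a.1 - 1)) (τ a.1) i
  have hf := linkPt_fst τ a i
  rcases Nat.lt_or_ge i.val 6 with hi | hi
  · rw [hca.inLayer ha i hi, hf, hz.2 hi]; ring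
  rcases Nat.lt_or_ge i.val 9 with hi' | hi'
  · rw [hs.1 i hi (by omega), hf, ho.2 ⟨hi, by omega⟩]; ring
  · rw [hs.2 i hi', hf, hn.2 hi']; ring

/-- ★ THE AFFINE LAYER LAW: on an all-cap-type Barlow-connected window, `(g x).1 = (g y).1 + s · (x.1 − y.1)` — the target layer is an affine function of
the source sheet with slope `±1`: sheets go to layers, consecutively (PLANE REGISTRATION of the parallel type). [this file, g79] -/
theorem layer_affine_of_reflTransGen {τ τ' : ℤ → Bool} {g : ℤ × ℤ × ℤ → ℤ × ℤ × ℤ} {W : Set (ℤ × ℤ × ℤ)} {y : ℤ × ℤ × ℤ} {s : ℤ}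
    (hy : UpSign τ g y s) (hmaps : ∀ z ∈ W, IsLinkMap τ τ' g z) (hcapW : ∀ z ∈ W, CapType τ g z) {x : ℤ × ℤ × ℤ}
    (h : Relation.ReflTransGen (fun a c => a ∈ W ∧ c ∈ W ∧ BarlowAdj τ a c) y x) : (g x).1 - s * x.1 = (g y).1 - s * y.1 := by
  induction h with
  | refl => rfl
  | tail hab hbc ih => exact (layer_affine_step (hy.of_reflTransGen hmaps hcapW hab) (hmaps _ hbc.1) (hcapW _ hbc.1) hbc.2.2).trans ih

/-- ★★★ M3, ASSEMBLED (the combinatorial half of the transverse regime): on a Barlow-connected window carrying link maps into a constant-letter target (on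
the window and next to it), after ONE re-indexing `φ ∈ {id, resliceInv b 0, resliceInv b 1, resliceInv b 2}` of the target every vertex is cap-type with
ONE orientation sign `s = ±1`, sheet neighbours keep their target layer, and the target layer is AFFINE in the source sheet:
`(φ (g x)).1 − s · x.1 = (φ (g y)).1 − s · y.1` on `W`. [this file, g79] -/
theorem exists_reslice_layerLaw {τ : ℤ → Bool} {b : Bool} {g : ℤ × ℤ × ℤ → ℤ × ℤ × ℤ} {W : Set (ℤ × ℤ × ℤ)}
    (hmaps : ∀ z ∈ W, IsLinkMap τ (fun _ => b) g z) (hnb : ∀ z ∈ W, ∀ i, IsLinkMap τ (fun _ => b) g (linkPt τ z i)) {y : ℤ × ℤ × ℤ} (hy : y ∈ W)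
    (hconn : ∀ x ∈ W, Relation.ReflTransGen (fun a c => a ∈ W ∧ c ∈ W ∧ BarlowAdj τ a c) y x) :
    ∃ φ : ℤ × ℤ × ℤ → ℤ × ℤ × ℤ, (φ = id ∨ ∃ f : Fin 3, φ = resliceInv b f) ∧ ∃ s : ℤ, (s = 1 ∨ s = -1) ∧
      (∀ x ∈ W, CapType τ (φ ∘ g) x ∧ UpSign τ (φ ∘ g) x s ∧ ((φ ∘ g) x).1 - s * x.1 = ((φ ∘ g) y).1 - s * y.1) ∧
        ∀ x ∈ W, ∀ i : Fin 12, i.val < 6 → ((φ ∘ g) (linkPt τ x i)).1 = ((φ ∘ g) x).1 := by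
  obtain ⟨φ, hφ, hW⟩ := exists_reslice_capType hmaps hnb hy hconn
  have hm : ∀ x ∈ W, IsLinkMap τ (fun _ => b) (φ ∘ g) x := fun x hx => (hW x hx).1
  have hcapW : ∀ x ∈ W, CapType τ (φ ∘ g) x := fun x hx => (hW x hx).2.2
  obtain ⟨s, hs01, hsy⟩ := (hcapW y hy).exists_upSign (hm y hy)
  exact ⟨φ, hφ, s, hs01, fun x hx => ⟨hcapW x hx, hsy.of_reflTransGen hm hcapW (hconn x hx), layer_affine_of_reflTransGen hsy hm hcapW (hconn x hx)⟩,
    fun x hx i hi => (hcapW x hx).inLayer (hm x hx) i hi⟩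

end Summit.AtomisticToContinuum.Crystallization.Theorems.ChartedZeroExcessLayeredLatticeLiouville
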